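import Mathlib
import HarnessLib
import Summits.HubbardSuperconductivity.HubbardSuperconductivity.Theorems.KLProgrammeKLRegimeTwoVolumeTowerTruncProfileBridgeS
import Summits.HubbardSuperconductivity.HubbardSuperconductivity.Theorems.KLProgrammeKLRegimeTwoVolumeTowerSrcScaleChoice

/-!
# Route `KLProgramme` — crux K3, VL child `KLRegimeVolumeLimitV17F2` (stmt-HubbardSuperconductivity-20440), skeleton «cauchy» v11: THE RESCALED ONE-VOLUME BUNDLE
# `TowerVolumeDataTS` FROM THE DOORS' CONCLUSIONS (assembler step for `stub_vl_towerData`; seat hubbard-kl-k3c4-p1 g15; `--supports` 20440)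

`…TowerSrcScaledDefs.TowerVolumeDataTS V M β U μ K J ε t Λ κ aW sW NV` (field `hdata` of `TowerDataTS β U μ t`, per volume, eventually in `L`) has four fields.
This file assembles it, at ONE instance `(V, M, K)`, from the suppliers' conclusions BY SHAPE:

* `Z`      ⇐ the slice partition functions `Z^K_{Λ_{k+1}} ≠ 0`, `k ≤ J` (engine, `TowerP`);
* `parity` ⇐ `…TowerGenericFacts.klTowerD_parity` from the same;
* `cov`    ⇐ p3's step-covariance bundles `ScaleCovData (klStepCov V M β μ K j) (Λ j) (κ j) (aW j / ε) (sW j)`, `j < J` (hypothesis verbatim);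
* `profile`⇐ `…TowerTruncProfileBridgeS.wtProfileEven_srcTrunc_klTowerDS_of_readout`: E1's alive read-out `klWtPinnedSumAt V M β μ K j (r j) m (𝒱_{j+1}[K]) q w ≤ S₀ j m`
  (all degrees) ⊕ token #24 `SourceProfilesAtLev V M (S j) β U μ K j (r j) (j+1)` at a rate index `r j` with `Λ j ≤ klScale klE0 (r j)`, giving the budget
  **`NV j m := S₀ j (2m) + t·S j 1 (2m) + t²·S j 2 (2m)`**.

* **`towerVolumeDataTS_of_readout`** — the bundle; `towerVolumeDataTS_budget_le` — with the source scale of `…TowerSrcScaleChoice`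
  (`t·S j 1 m + t²·S j 2 m ≤ τ j·(if m ≤ 2 then 1 else klWtBudget P Q′ U (j+1) m)` when `S j = klSrcBudget P Q′ U A (j+1)`), the budget is below
  `S₀ j (2m) + τ j·(if 2m ≤ 2 then 1 else klWtBudget P Q′ U (j+1) (2m))` — the shape the (H3) generics `…TowerSmallnessGeom` consume.

Proofs only; no definition.  Honest framing: conditional assembly; nothing here asserts the read-outs, the stub, K3 or superconductivity.
[cite: BenfattoGiulianiMastropietro2006, §2.7 (2.70)–(2.71), §2.9 (4.3)–(4.8)]
-/

noncomputable section

namespace Summit.HubbardSuperconductivity.HubbardSuperconductivity.Theorems.TwoVolumeSource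

set_option linter.dupNamespace false -- summit = problem name (single-conjunct summit), D-0017

open Finset Filter Topology Literature.MathematicalPhysics.QuantumLattice GrassmannAlgebra Literature.Probability.LatticeModels
  Literature.Probability.LatticeModels.BattleFederbush
open Summit.HubbardSuperconductivity.HubbardSuperconductivity.Theorems.TwoPointAssembly
open Summit.HubbardSuperconductivity.HubbardSuperconductivity.Theorems.KLRegimeSplit
open Summit.HubbardSuperconductivity.HubbardSuperconductivity.Theorems.KLProgrammeLegKernels
open Summit.HubbardSuperconductivity.HubbardSuperconductivity.Theorems.EngineV8
open Summit.HubbardSuperconductivity.HubbardSuperconductivity.Theorems.TwoVolumeDefect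

variable {V M : ℕ} [NeZero V] [NeZero M]

/-- **`TowerVolumeDataTS` FROM THE DOORS' CONCLUSIONS** at one instance (see the module docstring). [folklore: assembly;
cite: BenfattoGiulianiMastropietro2006, §2.9 (4.3)-(4.8)] -/
theorem towerVolumeDataTS_of_readout {β : ℝ} (hβ : 0 < β) (U μ : ℝ) (K : TrigPolyC4v) (J : ℕ) {t : ℝ} (ht : 0 ≤ t)
    (Λ κ aW sW : ℕ → ℝ) (r : ℕ → ℕ) (hΛr : ∀ j, j ≤ J → Λ j ≤ klScale klE0 (r j))
    -- partition functions of the slices `Λ_{k+1}`, `k ≤ J`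
    (hZ : ∀ k, k ≤ J → hubbardEffPartitionFnCT V M β U μ 0 K (klScale klE0 (k + 1)) ≠ 0)
    -- p3's step-covariance bundles
    (hcov : ∀ j, j < J → ScaleCovData (klStepCov V M β μ K j) (Λ j) (κ j) (aW j / imagTimeWeight β M) (sW j))
    -- E1's alive read-out and token #24, per scale
    (S₀ : ℕ → ℕ → ℝ) (S : ℕ → ℕ → ℕ → ℝ) (hS₀ : ∀ j m, 0 ≤ S₀ j m) (hS : ∀ j s m, 0 ≤ S j s m)
    (h0 : ∀ j, j ≤ J → ∀ (m : ℕ) (q : Fin m) (w : SpaceTimeIdx V M × SectorLeg (sectorCount j)),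
      klWtPinnedSumAt V M β μ K j (r j) m (klEffectiveAction V M β U μ K klE0 (j + 1)) q w ≤ S₀ j m)
    (h12 : ∀ j, j ≤ J → SourceProfilesAtLev V M (S j) β U μ K j (r j) (j + 1)) :
    TowerVolumeDataTS V M β U μ K J (imagTimeWeight β M) t Λ κ aW sW
      (fun j m => S₀ j (2 * m) + t * S j 1 (2 * m) + t ^ 2 * S j 2 (2 * m)) where
  Z k hk := hZ k (by omega)
  parity j hj := klTowerD_parity β U μ K j (hZ j hj)
  cov := hcov
  profile j hj := wtProfileEven_srcTrunc_klTowerDS_of_readout hβ U μ K ht j (r j) (hΛr j hj) (S₀ j) (S j) (hS₀ j) (hS j) (h0 j hj) (h12 j hj)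

/-- **The budget of `towerVolumeDataTS_of_readout` under the source scale of `…TowerSrcScaleChoice`**: if `t·S j 1 m + t²·S j 2 m ≤ τ j · w j m` for all `m`
(`w j m` the producer's degree law, e.g. `if m ≤ 2 then 1 else klWtBudget P Q′ U (j+1) m`), then
`S₀ j (2m) + t·S j 1 (2m) + t²·S j 2 (2m) ≤ S₀ j (2m) + τ j · w j (2m)`. [folklore] -/
theorem towerVolumeDataTS_budget_le (S₀ : ℕ → ℕ → ℝ) (S : ℕ → ℕ → ℕ → ℝ) (τ : ℕ → ℝ) (w : ℕ → ℕ → ℝ) {t : ℝ} (j : ℕ)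
    (hle : ∀ m, t * S j 1 m + t ^ 2 * S j 2 m ≤ τ j * w j m) (m : ℕ) :
    S₀ j (2 * m) + t * S j 1 (2 * m) + t ^ 2 * S j 2 (2 * m) ≤ S₀ j (2 * m) + τ j * w j (2 * m) := by
  have h := hle (2 * m)
  linarith

/-- **The rescaled bundle with the producer's budgets** `S j s m = klSrcBudget P Q′ U A (j+1) s m` and the source scale chosen by
`…TowerSrcScaleChoice.exists_srcScale_klSrcBudget_le`: for every instance where the read-outs hold, `TowerVolumeDataTS … t … NV` with
`NV j m ≤ S₀ j (2m) + τ j · (if 2m ≤ 2 then 1 else klWtBudget P Q′ U (j+1) (2m))`. [cite: BenfattoGiulianiMastropietro2006, §2.9 (4.6)-(4.8)] -/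
theorem towerVolumeDataTS_of_readout_klSrcBudget {β : ℝ} (hβ : 0 < β) (U μ : ℝ) (K : TrigPolyC4v) (J : ℕ)
    (P : SplitConsts) (Q' : EngConsts) (A : ℕ → ℕ → ℝ) (hCE : 0 ≤ Q'.CE) (hK : 0 ≤ P.Klam) (hA : ∀ j s, 0 ≤ A j s)
    {t : ℝ} (ht0 : 0 < t) (τ : ℕ → ℝ)
    (htτ : ∀ j, j ≤ J → ∀ m : ℕ,
      t * klSrcBudget P Q' U A (j + 1) 1 m + t ^ 2 * klSrcBudget P Q' U A (j + 1) 2 m ≤ τ j * (if m ≤ 2 then 1 else klWtBudget P Q' U (j + 1) m))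
    (Λ κ aW sW : ℕ → ℝ) (r : ℕ → ℕ) (hΛr : ∀ j, j ≤ J → Λ j ≤ klScale klE0 (r j))
    (hZ : ∀ k, k ≤ J → hubbardEffPartitionFnCT V M β U μ 0 K (klScale klE0 (k + 1)) ≠ 0)
    (hcov : ∀ j, j < J → ScaleCovData (klStepCov V M β μ K j) (Λ j) (κ j) (aW j / imagTimeWeight β M) (sW j))
    (S₀ : ℕ → ℕ → ℝ) (hS₀ : ∀ j m, 0 ≤ S₀ j m)
    (h0 : ∀ j, j ≤ J → ∀ (m : ℕ) (q : Fin m) (w : SpaceTimeIdx V M × SectorLeg (sectorCount j)),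
      klWtPinnedSumAt V M β μ K j (r j) m (klEffectiveAction V M β U μ K klE0 (j + 1)) q w ≤ S₀ j m)
    (h12 : ∀ j, j ≤ J → SourceProfilesAtLev V M (klSrcBudget P Q' U A (j + 1)) β U μ K j (r j) (j + 1)) :
    TowerVolumeDataTS V M β U μ K J (imagTimeWeight β M) t Λ κ aW sW
        (fun j m => S₀ j (2 * m) + t * klSrcBudget P Q' U A (j + 1) 1 (2 * m) + t ^ 2 * klSrcBudget P Q' U A (j + 1) 2 (2 * m)) ∧
      (∀ j, j ≤ J → ∀ m, 0 ≤ S₀ j (2 * m) + t * klSrcBudget P Q' U A (j + 1) 1 (2 * m) + t ^ 2 * klSrcBudget P Q' U A (j + 1) 2 (2 * m)) ∧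
      (∀ j, j ≤ J → ∀ m, S₀ j (2 * m) + t * klSrcBudget P Q' U A (j + 1) 1 (2 * m) + t ^ 2 * klSrcBudget P Q' U A (j + 1) 2 (2 * m) ≤
        S₀ j (2 * m) + τ j * (if 2 * m ≤ 2 then 1 else klWtBudget P Q' U (j + 1) (2 * m))) := by
  have hSB : ∀ j s m, 0 ≤ klSrcBudget P Q' U A j s m := fun j s m => by
    unfold klSrcBudget
    refine mul_nonneg (hA j s) ?_
    split_ifs
    · exact zero_le_one
    · exact klWtBudget_nonneg hCE hK U j m
  refine ⟨towerVolumeDataTS_of_readout hβ U μ K J ht0.le Λ κ aW sW r hΛr hZ hcov S₀ (fun j s m => klSrcBudget P Q' U A (j + 1) s m) hS₀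
      (fun j s m => hSB (j + 1) s m) h0 h12, fun j _ m => ?_, fun j hj m => ?_⟩
  · exact add_nonneg (add_nonneg (hS₀ j _) (mul_nonneg ht0.le (hSB _ _ _))) (mul_nonneg (sq_nonneg t) (hSB _ _ _))
  · exact towerVolumeDataTS_budget_le S₀ (fun j s m => klSrcBudget P Q' U A (j + 1) s m) τ
      (fun j m => if m ≤ 2 then (1 : ℝ) else klWtBudget P Q' U (j + 1) m) j (htτ j hj) m

end Summit.HubbardSuperconductivity.HubbardSuperconductivity.Theorems.TwoVolumeSource

end
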